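import Literature.Probability.Percolation.SlabAnnulusCircuits
import Literature.Probability.Percolation.SlabRSWGluingContact
import HarnessLib

/-!
# Newman–Tassion–Wu 2017, Theorem 3.8 / CPAM Theorem 3.10 — the data of the CIRCUIT gluing lemma
# (vertical surgery at a column of the minimal circuit)

Topic: `Literature/Probability/Percolation`.  First file of the lead's CIRCUIT GLUING LAYER of the port
of Newman–Tassion–Wu, *Critical percolation and the minimal spanning tree in slabs* (CPAM 70 (2017) =
arXiv:1512.09107): §3.2, the gluing lemma for CIRCUITS (CPAM Theorem 3.10, (3.5)–(3.6), pp. 14–16;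
arXiv Theorem 3.8).  NTW: "it will be easier to glue a circuit with a path than gluing two paths. This
is due to the fact that the local modification performed in this case does not create a new circuit,
and the reconstruction step is easier … Close all the edges in `B₁(z)` except those in `Γ₁(ω)` and
`κ_z`.  Let `u ∈ ẑ ∩ Γ₁(ω)` and `v ∈ ẑ ∩ κ_z` … open all the vertical edges between `u` and `v` …
the local modification above does not create any new circuit … one can reconstruct `ω` by noting that
`u ∈ κ_z` is the only site on `Γ₁(ω^{(z)}) = Γ₁(ω)` that connects to `Γ₂(ω)` without using any other
edges in `Γ₁`."

Compared with the path gluing data `GlueData` (`SlabRSWGluingCore.lean`: the minimal PATH `Γ_min^S(A,B)`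
is rerouted inside a cleared box, which needs the routing lemma and a locally rectangular domain), the
circuit version has: the structure `Γ = Γ_min` = the tree's `minCircuit` of an annulus `A_{m,n}(c)`
(`SlabAnnulusCircuits.lean`), an arbitrary finite planar WORLD `W ⊇ A_{m,n}(c)` inside which
connections are counted, and a SOURCE `src ω ⊆ C̄supp` which may depend on the configuration through
pairs not touching the columns over `B_n(c)` (so that it can be the other minimal circuit, as in
(3.5)–(3.6)).  The gadget is one column: no routing, no condition on the shape of `W`.

* `NTW17.CircGlue k` — the data `(c, m, n, W, Csupp, src)` with its side conditions.
* `CircGlue.Γ`, `.evH` (the circuit exists), `.evCol` (`C̄ ⟷^{W̄}` a vertex in a column of `Γ`),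
  `.evGlued` (`C̄ ⟷^{W̄} Γ`), `.evX = evCol ∖ evGlued` (NTW's `𝒳`), `.JoinedFar`, `.Uent` (entry cells
  = NTW's `U(ω)` at distance `0`), `.att` (the recovery statistic: vertices of `Γ` joined to `C̄` by an
  open path meeting `Γ` only at its end), `NTW17.CircGlue.VGadget` (what the vertical surgery
  delivers at a cell `y`).
* Basic facts: `near_zero_iff`, `evCol_subset_evH`, `not_near_src`, `Uent_subset`, `Uent_finite`,
  `Γ_congr`, `src_congr`.

## Sources

* C. M. Newman, V. Tassion, W. Wu, *Critical percolation and the minimal spanning tree in slabs*,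
  Comm. Pure Appl. Math. 70 (2017) 2084–2120 = arXiv:1512.09107: §3.2, Theorem 3.8 (arXiv) =
  Theorem 3.10 (CPAM) and its proof, (3.5)–(3.8) [NewmanTassionWu2017].
-/

noncomputable section

namespace Literature.Probability.Percolation

open MeasureTheory LatticeModels SimpleGraph

namespace NTW17

/-- `Near k γ 0 y` says that `y` is the projection of a vertex of `γ`. [cite: NewmanTassionWu2017, §3.2 (Theorem 3.7, 𝒩(Γ̄, r) with r = 0)] -/
theorem near_zero_iff {k : ℕ} {γ : List (slab 3 k)} {y : ℤ × ℤ} :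
    Near k γ 0 y ↔ ∃ g ∈ γ, planar k g = y := by
  constructor
  · rintro ⟨g, hg, hy⟩
    refine ⟨g, hg, ?_⟩
    rw [mem_sqBox_iff'] at hy
    ext <;> push_cast at hy <;> omega
  · rintro ⟨g, hg, rfl⟩
    exact ⟨g, hg, mem_sqBox_self _ _⟩

/-- **The data of NTW's circuit gluing lemma**: an annulus `A_{m,n}(c)` (whose minimal surrounding
open circuit `Γ` is the structure to be glued to), a finite planar world `W ⊇ A_{m,n}(c)` inside which
connections are counted, and a source `src ω` of slab vertices over a planar set `Csupp ⊆ W` disjoint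
from `B_n(c)`, depending on `ω` only through the pairs over `W` that do not touch the columns over
`B_n(c)`. [cite: NewmanTassionWu2017, §3.2 (CPAM Theorem 3.10: the sets R, Γ₁, Γ₂ of (3.5)–(3.6))] -/
structure CircGlue (k : ℕ) where
  /-- centre of the annulus -/
  c : ℤ × ℤ
  /-- inner radius -/
  m : ℕ
  /-- outer radius -/
  n : ℕ
  /-- the world -/
  W : Set (ℤ × ℤ)
  /-- planar support of the source -/
  Csupp : Set (ℤ × ℤ)
  /-- the source (possibly configuration-dependent) -/
  src : BondConfig (slab 3 k) → Set (slab 3 k)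
  /-- the world is finite -/
  hWfin : W.Finite
  /-- the annulus lies in the world -/
  hAW : annulus c m n ⊆ W
  /-- the source lies in the world -/
  hCW : Csupp ⊆ W
  /-- the source is off the columns over `B_n(c)` -/
  hCfar : Disjoint Csupp (sqBox c n)
  /-- the source lies over its support -/
  hsrc : ∀ ω, src ω ⊆ slabLift k Csupp
  /-- the source is determined by the pairs over `W` not touching the columns over `B_n(c)` -/
  hsrc_loc : ∀ ω ω' : BondConfig (slab 3 k),
    (∀ e ∈ (slabLift k W).sym2, e ∉ touch k (sqBox c n) → (e ∈ ω ↔ e ∈ ω')) → src ω = src ω'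

namespace CircGlue

variable {k : ℕ} (D : CircGlue k)

/-- **`Γ = Γ_min`**, the minimal open circuit of `Ā_{m,n}(c)` surrounding `B̄_m(c)` (empty if none).
[cite: NewmanTassionWu2017, §3.2 (CPAM Theorem 3.10, Γ₁)] -/
def Γ (ω : BondConfig (slab 3 k)) : List (slab 3 k) := minCircuit k ω D.c D.m D.n

/-- The event that `Γ` exists (`𝒜_{m,n}(c)`). [cite: NewmanTassionWu2017, §3.2 (CPAM Theorem 3.10, a(m,n))] -/
def evH : Set (BondConfig (slab 3 k)) := circuitAround k D.c D.m D.n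

/-- **`C̄ ⟷^{W̄} Γ̄`-columns**: some source vertex is joined inside `W̄` to a vertex projecting onto the
projection of `Γ` (NTW's `Γ₁ ≈ Γ₂` / `C ⟷ 𝒩(Γ, 0)`). [cite: NewmanTassionWu2017, §3.2 (CPAM Theorem 3.10, (3.5)–(3.6))] -/
def evCol : Set (BondConfig (slab 3 k)) :=
  {ω | ∃ c₀ ∈ D.src ω, ∃ q, ω ∈ openConnIn (slabLift k D.W) c₀ q ∧ Near k (D.Γ ω) 0 (planar k q)}

/-- **`C̄ ⟷^{W̄} Γ`**: some source vertex is joined inside `W̄` to a VERTEX of `Γ` (NTW's `Γ₁ ⟷^R Γ₂`).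
[cite: NewmanTassionWu2017, §3.2 (CPAM Theorem 3.10, (3.5))] -/
def evGlued : Set (BondConfig (slab 3 k)) :=
  {ω | ∃ c₀ ∈ D.src ω, ∃ g ∈ D.Γ ω, ω ∈ openConnIn (slabLift k D.W) c₀ g}

/-- **NTW's `𝒳`** for circuits: the columns of `Γ` are reached but `Γ` itself is not.
[cite: NewmanTassionWu2017, §3.2 (CPAM Theorem 3.10, the event {Γ₁ ≈ Γ₂, Γ₁ ↮ Γ₂})] -/
def evX : Set (BondConfig (slab 3 k)) := D.evCol ∩ (D.evGlued)ᶜ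

/-- **`u` is joined to the source off the columns of `Γ`** (NTW's paths `κ_z`). [cite: NewmanTassionWu2017, §3.2 (CPAM Theorem 3.10, U(ω))] -/
def JoinedFar (ω : BondConfig (slab 3 k)) (u : slab 3 k) : Prop :=
  ∃ c₀ ∈ D.src ω, ω ∈ openConnIn (slabLift k D.W ∩ {x | ¬Near k (D.Γ ω) 0 (planar k x)}) c₀ u

/-- **The entry cells `U(ω)`**: projections `y` of vertices of `Γ` such that some lattice pair `{u, v}`
has `v` over `y`, `u` off the columns of `Γ`, and `u` joined to the source off the columns of `Γ`.
[cite: NewmanTassionWu2017, §3.2 (CPAM Theorem 3.10, U(ω) = {z ∈ R : z ∈ Γ̄₁, z connected to Γ₂})] -/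
def Uent (ω : BondConfig (slab 3 k)) : Set (ℤ × ℤ) :=
  {y | Near k (D.Γ ω) 0 y ∧ ∃ u v : slab 3 k, planar k v = y ∧ (slabGraph 3 k).Adj u v ∧
    ¬Near k (D.Γ ω) 0 (planar k u) ∧ D.JoinedFar ω u}

/-- **The recovery statistic**: the vertices `x` of `Γ` joined to the source inside `W̄` by an open path
meeting `Γ` only at `x` (NTW: "the only site on `Γ₁(ω^{(z)})` that connects to `Γ₂` without using any
other edges in `Γ₁`"). [cite: NewmanTassionWu2017, §3.2 (CPAM Theorem 3.10, reconstruction of z)] -/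
def att (ω : BondConfig (slab 3 k)) : Set (slab 3 k) :=
  {x | x ∈ D.Γ ω ∧ ∃ c₀ ∈ D.src ω, ω ∈ openConnIn (slabLift k D.W ∩ {z | z ∉ D.Γ ω ∨ z = x}) c₀ x}

/-- **What the vertical surgery at the cell `y` delivers**: a configuration in `{C̄ ⟷ Γ}` made of old
pairs and lattice pairs over `W`, agreeing with `ω` off the pairs touching the column over `y`, with the
SAME minimal circuit, and whose recovery statistic is non-empty and lies over `y`.
[cite: NewmanTassionWu2017, §3.2 (CPAM Theorem 3.10, the configuration ω^{(z)})] -/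
structure VGadget (D : CircGlue k) (ω ω' : BondConfig (slab 3 k)) (y : ℤ × ℤ) : Prop where
  /-- the image glues the source to `Γ` -/
  mem : ω' ∈ D.evGlued
  /-- the image is made of old pairs and lattice pairs over the world -/
  window : ∀ e ∈ ω', e ∈ ω ∨ (e ∈ (slabGraph 3 k).edgeSet ∧ e ∈ (slabLift k D.W).sym2)
  /-- the modification is confined to the column over `y` -/
  agree : ∀ e, e ∉ touch k ({y} : Set (ℤ × ℤ)) → (e ∈ ω ↔ e ∈ ω')
  /-- the minimal circuit is unchanged -/
  Γ_eq : D.Γ ω' = D.Γ ω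
  /-- the statistic is non-empty -/
  att_nonempty : (D.att ω').Nonempty
  /-- the statistic lies over `y` -/
  att_subset : D.att ω' ⊆ slabLift k ({y} : Set (ℤ × ℤ))

variable {D}

/-! ## Basic facts -/

/-- On `evCol` the circuit exists. [cite: NewmanTassionWu2017, §3.2 (CPAM Theorem 3.10)] -/
theorem evCol_subset_evH : D.evCol ⊆ D.evH := by
  rintro ω ⟨c₀, -, q, -, g, hg, -⟩
  by_contra h
  have : D.Γ ω = [] := minCircuit_eq_nil h
  rw [this] at hg; simp at hg

/-- On `evX` the circuit exists. [cite: NewmanTassionWu2017, §3.2 (CPAM Theorem 3.10)] -/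
theorem evH_of_evX {ω : BondConfig (slab 3 k)} (h : ω ∈ D.evX) : ω ∈ D.evH := evCol_subset_evH h.1

/-- The minimal circuit, when it exists, is a surrounding open circuit of the annulus and is minimal.
[cite: NewmanTassionWu2017, §3.2 (CPAM Theorem 3.10, Γ₁)] -/
theorem Γ_spec {ω : BondConfig (slab 3 k)} (h : ω ∈ D.evH) :
    (IsOpenCircuit k ω (slabLift k (annulus D.c D.m D.n)) (D.Γ ω) ∧ Surrounds k D.c (D.Γ ω)) ∧
      ∀ l, IsOpenCircuit k ω (slabLift k (annulus D.c D.m D.n)) l → Surrounds k D.c l →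
        pathKey k (D.Γ ω) ≤ pathKey k l :=
  minCircuit_spec h

/-- The vertices of `Γ` project into the annulus, hence into `B_n(c)` and into the world.
[cite: NewmanTassionWu2017, §3.2 (CPAM Theorem 3.10, Γ₁ ⊆ A_{m,n})] -/
theorem planar_mem_of_mem_Γ {ω : BondConfig (slab 3 k)} {g : slab 3 k} (hg : g ∈ D.Γ ω) :
    planar k g ∈ annulus D.c D.m D.n ∧ planar k g ∈ sqBox D.c D.n ∧ planar k g ∈ D.W := by
  by_cases h : ω ∈ D.evH
  · have h1 : planar k g ∈ annulus D.c D.m D.n := (Γ_spec h).1.1.subset g hg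
    exact ⟨h1, annulus_subset_sqBox _ _ _ h1, D.hAW h1⟩
  · have : D.Γ ω = [] := minCircuit_eq_nil h
    rw [this] at hg; simp at hg

/-- A cell in a column of `Γ` lies in `B_n(c)` and in the world. [cite: NewmanTassionWu2017, §3.2 (CPAM Theorem 3.10)] -/
theorem mem_of_near_zero {ω : BondConfig (slab 3 k)} {y : ℤ × ℤ} (hy : Near k (D.Γ ω) 0 y) :
    y ∈ annulus D.c D.m D.n ∧ y ∈ sqBox D.c D.n ∧ y ∈ D.W := by
  obtain ⟨g, hg, rfl⟩ := near_zero_iff.1 hy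
  exact planar_mem_of_mem_Γ hg

/-- **Source vertices are off the columns of `Γ`.** [cite: NewmanTassionWu2017, §3.2 (CPAM Theorem 3.10: the annuli are disjoint)] -/
theorem not_near_src {ω ω₁ : BondConfig (slab 3 k)} {c₀ : slab 3 k} (hc₀ : c₀ ∈ D.src ω₁) :
    ¬Near k (D.Γ ω) 0 (planar k c₀) := by
  intro h
  have h1 : planar k c₀ ∈ D.Csupp := by
    have := D.hsrc ω₁ hc₀; rwa [mem_slabLift_iff] at this
  exact Set.disjoint_left.1 D.hCfar h1 (mem_of_near_zero h).2.1

/-- Source vertices lie over the world. [cite: NewmanTassionWu2017, §3.2 (CPAM Theorem 3.10)] -/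
theorem src_subset_W (ω : BondConfig (slab 3 k)) : D.src ω ⊆ slabLift k D.W := fun x hx => by
  have := D.hsrc ω hx
  rw [mem_slabLift_iff] at this ⊢
  exact D.hCW this

/-- Entry cells are columns of `Γ`; in particular they lie in `B_n(c)` and in the world.
[cite: NewmanTassionWu2017, §3.2 (CPAM Theorem 3.10, U(ω) ⊆ Γ̄₁)] -/
theorem Uent_subset (ω : BondConfig (slab 3 k)) :
    D.Uent ω ⊆ {y | Near k (D.Γ ω) 0 y} := fun _ hy => hy.1

/-- `U(ω)` is finite. [cite: NewmanTassionWu2017, §3.2 (CPAM Theorem 3.10, U(ω) ⊆ Γ̄₁)] -/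
theorem Uent_finite (ω : BondConfig (slab 3 k)) : (D.Uent ω).Finite := by
  have h : D.Uent ω ⊆ (planar k) '' {x | x ∈ D.Γ ω} := fun y hy => by
    obtain ⟨g, hg, rfl⟩ := near_zero_iff.1 hy.1; exact ⟨g, hg, rfl⟩
  exact ((List.finite_toSet _).image _).subset h

/-- `Γ` is determined by the pairs over `B_n(c)`. [cite: NewmanTassionWu2017, §3.2 (CPAM Theorem 3.10: "they are measurable with respect to the edge variables in" the annulus)] -/
theorem Γ_congr {ω ω' : BondConfig (slab 3 k)}
    (h : ∀ e ∈ (slabLift k (sqBox D.c D.n)).sym2, (e ∈ ω ↔ e ∈ ω')) : D.Γ ω = D.Γ ω' := by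
  refine minCircuit_local (Set.ext fun e => ?_)
  simp only [Set.mem_inter_iff]
  constructor
  · rintro ⟨he, hm⟩; exact ⟨(h e hm).1 he, hm⟩
  · rintro ⟨he, hm⟩; exact ⟨(h e hm).2 he, hm⟩

/-- Two configurations agreeing off the pairs touching one column of `B_n(c)` have the same source.
[cite: NewmanTassionWu2017, §3.2 (CPAM Theorem 3.10: the local modification does not change Γ₂)] -/
theorem src_congr_of_agree {ω ω' : BondConfig (slab 3 k)} {y : ℤ × ℤ} (hy : y ∈ sqBox D.c D.n)
    (h : ∀ e, e ∉ touch k ({y} : Set (ℤ × ℤ)) → (e ∈ ω ↔ e ∈ ω')) : D.src ω = D.src ω' := by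
  refine D.hsrc_loc ω ω' fun e _ he => h e fun ht => he ?_
  obtain ⟨x, hx, hxy⟩ := ht
  exact ⟨x, hx, by rw [Set.mem_singleton_iff] at hxy; rwa [hxy]⟩

/-- Unfolding `evX`. [cite: NewmanTassionWu2017, §3.2 (CPAM Theorem 3.10)] -/
theorem mem_evX_iff {ω : BondConfig (slab 3 k)} : ω ∈ D.evX ↔ ω ∈ D.evCol ∧ ω ∉ D.evGlued := Iff.rfl

/-- On `evX`, no source vertex is joined inside `W̄` to a vertex of `Γ`. [cite: NewmanTassionWu2017, §3.2 (CPAM Theorem 3.10, Γ₁ ↮ Γ₂)] -/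
theorem not_joined_of_evX {ω : BondConfig (slab 3 k)} (hX : ω ∈ D.evX) {c₀ g : slab 3 k}
    (hc₀ : c₀ ∈ D.src ω) (hg : g ∈ D.Γ ω) : ω ∉ openConnIn (slabLift k D.W) c₀ g :=
  fun h => hX.2 ⟨c₀, hc₀, g, hg, h⟩

/-- A far-joined vertex lies over the world and off the columns of `Γ`. [cite: NewmanTassionWu2017, §3.2 (CPAM Theorem 3.10)] -/
theorem JoinedFar.mem {ω : BondConfig (slab 3 k)} {u : slab 3 k} (h : D.JoinedFar ω u) :
    u ∈ slabLift k D.W ∧ ¬Near k (D.Γ ω) 0 (planar k u) := by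
  obtain ⟨c₀, -, hj⟩ := h
  obtain ⟨-, hu, -⟩ := hj
  exact hu

end CircGlue

end NTW17

end Literature.Probability.Percolation

end
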